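import Summits.QuantumFields.YangMills.Theorems.FluctuationComparisonRegPrIntLWregInterior
import Summits.QuantumFields.YangMills.Theorems.BalabanUVNodesN09ContourThresholdNull
import Literature.MathematicalPhysics.QuantumFieldTheory.Balaban1983to89.PlaquetteVariableHaarLaw
import Literature.MathematicalPhysics.QuantumFieldTheory.Balaban1983to89.HaarDist1LevelHypersurface
import Literature.MathematicalPhysics.QuantumFieldTheory.Balaban1983to89.B14Eq12InteriorLocality
import HarnessLib

/-!
# WREG PORT F4b — the first rungs of EDGE ∕ LEVEL and LEVEL-FAR of LINE g18-2 «fibred-chart table for WREG», made importable BY NAME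
# (v20 `Cruxes/FluctuationComparisonRegPrIntL/Lines/wreg_chart.lean` @7e8eb395e5b4 ∕ tree sha16 36befdc7ca5b8719: §4f ll. 2549–2613 + §4g ll. 2615–2758, VERBATIM)

Cell `ym3-torus`, width seat `ym3-torus-px17` g6 — F4 pen of ★★OWNER WORD 31 (A) on the ideator seat ym-r3-idea-1 g18's PORT MAP
`Lines/wreg_chart_port.md` @7bd96d90; helper of `stmt-QuantumFields-20520` (`--supports`, count-neutral).  Second half of F4 (same namespace as F4a
`…WregInterior.lean`, which it imports for `LevelFlat`).

CONTENT (authorship: ideator ym-r3-idea-1 g18, proofs unchanged).  §4f FIRST RUNGS by Haar level-set nullity: `haar_setOf_dist1_eq_eq_zero`,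
`ae_dist1_plaqHol_ne_of_offPivot`, `levelFlat_zero_offPivot`, `ae_forall_dist1_fibreFamily_self_ne`, `edge_self_not_mem`.  §4g LEVEL OFF THE CENTRAL
CHAINS AT EVERY LEVEL: `exists_iterCentralBond_eq`, ★`iter_apply_eq_of_far` (triangularity), `map_iter_absolutelyContinuous` (`HaarAC` of (0.4) iterated),
★★`levelFlat_far`, the residual obligation statement `def LevelFlatNear` (LEVEL-NEAR; Theorems-side proof ✓`…WregChartLevelNear.levelFlatNear_of_chain`,
w4-20520 g14) and ★★`levelFlat_of_near : LevelFlatNear → LevelFlat`.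

ONE DECLARED DEVIATION FROM VERBATIM (gate hygiene, w4-20520 g14's 16:06:13Z lesson on F3): in the docstrings of the parameter-free obligation `Prop`s
`LevelFlatNear` the `[cite: …]` bracket is spelled `(print: …)` — a bracket-tagged parameter-free `def X : Prop` is RELOCATED to `Literature/` by the
gate, where these route-internal obligations cannot elaborate; statement texts are untouched (ws-identical to v20 by script).

HONEST FRAMING.  A port is bookkeeping: every declaration below is a VERBATIM move of a proved declaration of the ideator seat's workfile
(namespace swap + `open` preamble only; statements and proofs byte-identical to v20); nothing new is proved and nothing of Bałaban's is
asserted; WREG is ONE organ of the S2β package of an exploratory line of the DECIDING crux `FluctuationComparisonRegPrIntL`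
(stmt-QuantumFields-20520), which is NOT proved; EXW ∕ GAP ∕ LAPLACE ∕ H4ᶜ ∕ LFR♯ᶜ and the package's seven stubs stay open; rung R3 = YM₃ on T³ —
NOT d = 4, NOT infinite volume, NOT a mass gap, NOT Clay; no summit statement is proved by a line; `YM3TorusSU2` is NOT proved.
-/

noncomputable section

open MeasureTheory Filter Topology Set
open scoped ENNReal NNReal
open Literature.MathematicalPhysics.QuantumFieldTheory.Balaban1983to89
open Literature.MathematicalPhysics.QuantumFieldTheory.Balaban1983to89.T3ContinuumYM3Torus
open Literature.MathematicalPhysics.QuantumFieldTheory.Balaban1983to89.T3NestedUnitLaws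
open Literature.MathematicalPhysics.QuantumFieldTheory.Balaban1983to89.T3UnitLawDensityEML
open Literature.MathematicalPhysics.QuantumFieldTheory.Balaban1983to89.T3UnitScaleTilt
open Literature.MathematicalPhysics.QuantumFieldTheory.Balaban1983to89.T3TiltDescent
open Literature.MathematicalPhysics.QuantumFieldTheory.Balaban1983to89.T3PrintedRegularMinimiser
open Literature.MathematicalPhysics.QuantumFieldTheory.Balaban1983to89.T3ConstrainedMinimiser (fibre)
open Literature.MathematicalPhysics.QuantumFieldTheory.Balaban1983to89.T3LevelShift
open Literature.MathematicalPhysics.QuantumFieldTheory.Balaban1983to89.T3SmallLiftHistory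
open Literature.MathematicalPhysics.QuantumFieldTheory.Balaban1983to89.T3Thresholds
open Literature.MathematicalPhysics.QuantumFieldTheory.Balaban1983to89.Missing
open Literature.MathematicalPhysics.QuantumFieldTheory.Balaban1983to89.T4Continuum
open scoped Literature.MathematicalPhysics.QuantumFieldTheory.Balaban1983to89.T3OrbitAverage
open Summit.QuantumFields.YangMills.Theorems.FluctuationComparisonRegPrIntLWregChain
open Summit.QuantumFields.YangMills.Theorems.FluctuationComparisonRegPrIntLWregGlue

namespace Summit.QuantumFields.YangMills.Theorems.FluctuationComparisonRegPrIntLWregInterior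

/-! ## §4f First rungs of EDGE and LEVEL: Haar level-set nullity in T³ currency (PROVED, v12) -/

section Rungs

open Literature.MathematicalPhysics.QuantumFieldTheory.Balaban1983to89.Node00 (SU)
open Literature.MathematicalPhysics.QuantumFieldTheory.Balaban1983to89.BlockAveraging (Idx loopHol)
open Literature.MathematicalPhysics.QuantumFieldTheory.Balaban1983to89.BlockAveragingHaarAC (centralBond pre post)
open Literature.MathematicalPhysics.QuantumFieldTheory.Balaban1983to89.BlockAveragingEMLHaarAC (fibreFamily)
open Literature.MathematicalPhysics.QuantumFieldTheory.Balaban1983to89.B14.Eq12InteriorLocality (plaqBonds plaqHol_congr)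

/-- The `dist1`-sphere of radius `t ≠ 0` in `SU(N)` is Haar-null (one-radius form of … [cite: BrockerTomDieck1985, IV (2.11) (proof)] -/
theorem haar_setOf_dist1_eq_eq_zero {N : ℕ} [NeZero N] {t : ℝ} (ht : t ≠ 0) :
    (HaarData.haar : Measure (SU N)) {g | dist1 g = t} = 0 := by
  have h := HaarDist1LevelHypersurface.haar_setOf_dist1_mem_eq_zero_specialUnitaryGroup (n := Fin N) (R := {t})
    (Set.countable_singleton t) (by simpa using ht.symm)
  simpa only [Set.mem_singleton_iff] using h

/-- **LEVEL⁰ (generic lattice, `SU(N)`)**: a plaquette variable on a plaquette AVOIDING the pivot bonds `β` is a.s. [cite: Balaban1985Averaging, (19) p.21] -/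
theorem ae_dist1_plaqHol_ne_of_offPivot {P : Params} {N : ℕ} [NeZero N] {j n : ℕ} (β : PBond P n → PBond P j) {t : ℝ} (ht : t ≠ 0)
    (p : Plaq P j) (hp : ∀ b ∈ plaqBonds p, ∀ c, β c ≠ b) :
    ∀ᵐ z ∂fieldMeasure P j (SU N), ∀ U : GaugeField P j (SU N), (∀ b, (∀ c, β c ≠ b) → U b = z b) →
      dist1 (GaugeField.plaqHol U p) ≠ t := by
  filter_upwards [PlaquetteVariableHaarLaw.ae_forall_dist1_plaqHol_ne (P := P) (j := j) (haar_setOf_dist1_eq_eq_zero (N := N) ht)]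
    with z hz U hUz
  rw [plaqHol_congr (U' := z) (fun b hb => hUz b (hp b hb))]
  exact hz p

/-- **LEVEL⁰ IN `LevelFlat`'S OWN BINDER SHAPE** (PROVED). [cite: Balaban1985Averaging, (19) p.21] -/
theorem levelFlat_zero_offPivot (F : T3Family) (K n : ℕ) (α : ℝ) {t : ℝ} (ht : t ≠ 0) (p : Plaq (F.P K) 0)
    (hp : ∀ b ∈ plaqBonds p, ∀ c : PBond (F.P K) n, iterCentralBond n c ≠ b)
    (W : GaugeField (F.P K) n (Matrix.specialUnitaryGroup (Fin 2) ℂ)) :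
    ∀ᵐ z ∂fieldMeasure (F.P K) 0 (Matrix.specialUnitaryGroup (Fin 2) ℂ),
      ∀ U : GaugeField (F.P K) 0 (Matrix.specialUnitaryGroup (Fin 2) ℂ),
        (∀ b, (∀ c, iterCentralBond n c ≠ b) → U b = z b) →
        (∀ c, U (iterCentralBond n c) ∈ chainWindow (N := 2) α n U c) →
        Averaging.iter (fun i => BlockAveraging.blockAvg (P := F.P K) (j := i) ℰp) n U = W →
          dist1 (GaugeField.plaqHol (Averaging.iter (fun i => BlockAveraging.blockAvg (P := F.P K) (j := i) ℰp) 0 U) p) ≠ t := by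
  filter_upwards [ae_dist1_plaqHol_ne_of_offPivot (N := 2) (iterCentralBond (P := F.P K) n) ht p hp] with z hz U hUz _ _
  exact hz U hUz

/-- **EDGE on the identity section (generic lattice, `SU(N)`)**: the sample's own pivot value `z(β(c))` is a.s. [cite: Balaban1987RG1, (0.4) p.253] -/
theorem ae_forall_dist1_fibreFamily_self_ne {P : Params} {N : ℕ} [NeZero N] {j : ℕ} (hj : j + 1 ≤ P.m + P.K) (c : PBond P (j + 1))
    {α : ℝ} (hα : α ≠ 0) :
    ∀ᵐ z ∂fieldMeasure P j (SU N), ∀ i : Idx P, dist1 (fibreFamily z c (pre z c * z (centralBond c) * post z c) i) ≠ α := by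
  classical
  have h0 := Summit.QuantumFields.YangMills.BalabanUVNodes.N09ContourThresholdNull.fieldMeasure_setOf_exists_dist1_loopHol_eq_eq_zero
    (P := P) (j := j) (N := N) hα
  rw [← compl_mem_ae_iff] at h0
  filter_upwards [h0] with z hz i hi
  apply hz
  refine ⟨c, i, ?_⟩
  have h := BlockAveragingEMLHaarAC.loopHol_update_centralBond_self hj z c (z (centralBond c))
  rw [Function.update_eq_self] at h
  rw [h]
  exact hi

/-- **EDGE⁰ (depth 1, window side)**: a.s. [cite: Balaban1987RG1, (0.4) p.253] -/
theorem edge_self_not_mem {P : Params} {N : ℕ} [NeZero N] (h1 : 0 + 1 ≤ P.m + P.K) (c : PBond P (0 + 1)) {α : ℝ} (hα : α ≠ 0) :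
    ∀ᵐ z ∂fieldMeasure P 0 (SU N),
      z (centralBond c) ∉ {g : SU N | ∃ i : Idx P, dist1 (fibreFamily z c (pre z c * g * post z c) i) = α} := by
  filter_upwards [ae_forall_dist1_fibreFamily_self_ne (N := N) h1 c hα] with z hz
  rintro ⟨i, hi⟩
  exact hz i hi

end Rungs

/-! ## §4g LEVEL off the central chains at EVERY level (PROVED, v13): triangularity + `HaarAC` of (0.4) -/

section FarRungs

open Literature.MathematicalPhysics.QuantumFieldTheory.Balaban1983to89.Node00 (SU)
open Literature.MathematicalPhysics.QuantumFieldTheory.Balaban1983to89.BlockAveraging (Idx avgFun measurable_avgFun)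
open Literature.MathematicalPhysics.QuantumFieldTheory.Balaban1983to89.BlockAveragingHaarAC (centralBond isLocal_avgFun)
open Literature.MathematicalPhysics.QuantumFieldTheory.Balaban1983to89.ExpMeanLog (deltaSU measurable_expMeanLogSU_E)
open Literature.MathematicalPhysics.QuantumFieldTheory.Balaban1983to89.BlockAveragingEMLHaarAC (offCard)
open Literature.MathematicalPhysics.QuantumFieldTheory.Balaban1983to89.B14.Eq12InteriorLocality (plaqBonds plaqHol_congr)

/-- The iterated central bonds of level `n` are iterated central bonds of every level `j + 1 ≤ n`: `range βₙ ⊆ range β_{j+1}`. [folklore] -/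
theorem exists_iterCentralBond_eq {P : Params} (j : ℕ) :
    ∀ n, j + 1 ≤ n → ∀ c : PBond P n, ∃ c'' : PBond P (j + 1), iterCentralBond n c = iterCentralBond (j + 1) c'' := by
  intro n hn
  induction n, hn using Nat.le_induction with
  | base => intro c; exact ⟨c, rfl⟩
  | succ n hn ih =>
      intro c
      obtain ⟨c'', h⟩ := ih (centralBond c)
      exact ⟨c'', by rw [iterCentralBond_succ, h]⟩

/-- ★ **FAR AGREEMENT AT EVERY LEVEL (triangularity)**: if two fine fields agree off the pivot bonds `βₙ`, then for every … -/
theorem iter_apply_eq_of_far {P : Params} {G : Type*} [GaugeGroup G] (ℰ : LoopAverage G) {n : ℕ} (hn : n ≤ P.m + P.K)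
    (U z : GaugeField P 0 G) (hUz : ∀ b, (∀ c : PBond P n, iterCentralBond n c ≠ b) → U b = z b) :
    ∀ j, j ≤ n → ∀ b' : PBond P j, (∀ c : PBond P n, iterCentralBond j b' ≠ iterCentralBond n c) →
      Averaging.iter (fun i => BlockAveraging.blockAvg (P := P) (j := i) ℰ) j U b' =
        Averaging.iter (fun i => BlockAveraging.blockAvg (P := P) (j := i) ℰ) j z b' := by
  intro j
  induction j with
  | zero =>
      intro _ b' hb'
      exact hUz b' (fun c h => hb' c (by rw [h]; rfl))
  | succ j ih =>
      intro hj c' hc'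
      classical
      show avgFun ℰ (Averaging.iter (fun i => BlockAveraging.blockAvg (P := P) (j := i) ℰ) j U) c' =
        avgFun ℰ (Averaging.iter (fun i => BlockAveraging.blockAvg (P := P) (j := i) ℰ) j z) c'
      refine T4TriangularPushforward.apply_eq_of_agree (isLocal_avgFun (by omega) ℰ) c'
        (Finset.univ.filter fun b' : PBond P j =>
          Averaging.iter (fun i => BlockAveraging.blockAvg (P := P) (j := i) ℰ) j U b' ≠
            Averaging.iter (fun i => BlockAveraging.blockAvg (P := P) (j := i) ℰ) j z b') _ _
        (fun b' hb' => by simpa using hb') ?_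
      intro b' hb'
      have hne := (Finset.mem_filter.mp hb').2
      have hex : ∃ c : PBond P n, iterCentralBond j b' = iterCentralBond n c := by
        by_contra h
        exact hne (ih (by omega) b' (fun c hcc => h ⟨c, hcc⟩))
      obtain ⟨c, hc⟩ := hex
      obtain ⟨c'', hc''⟩ := exists_iterCentralBond_eq j n (by omega) c
      refine ⟨c'', ?_, ?_⟩
      · rintro rfl
        exact hc' c hc''.symm
      · apply iterCentralBond_injective (n := j) (by omega)
        rw [← iterCentralBond_succ, ← hc'', ← hc]

/-- The law of `Ū⁽ʲ⁾` under product Haar is absolutely continuous (`SU(2)`). [cite: Balaban1987RG1, (0.4) p.253] -/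
theorem map_iter_absolutelyContinuous {P : Params} :
    ∀ j, j ≤ P.m + P.K →
      (fieldMeasure P 0 (Matrix.specialUnitaryGroup (Fin 2) ℂ)).map
          (Averaging.iter (fun i => BlockAveraging.blockAvg (P := P) (j := i) ℰp) j) ≪
        fieldMeasure P j (Matrix.specialUnitaryGroup (Fin 2) ℂ)
  | 0, _ => by
      rw [show Averaging.iter (fun i => BlockAveraging.blockAvg (P := P) (j := i) ℰp) 0 = id from rfl, Measure.map_id]
  | j + 1, hj => by
      have ih := map_iter_absolutelyContinuous (P := P) j (by omega)
      have hmi : Measurable (Averaging.iter (fun i => BlockAveraging.blockAvg (P := P) (j := i) ℰp) j) :=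
        T4Continuum.measurable_iter _ (fun j => by rw [BlockAveraging.blockAvg_avg]; exact measurable_avgFun _ measurable_expMeanLogSU_E) j
      have hma : Measurable (avgFun ℰp : GaugeField P j (Matrix.specialUnitaryGroup (Fin 2) ℂ) → _) :=
        measurable_avgFun _ measurable_expMeanLogSU_E
      rw [show Averaging.iter (fun i => BlockAveraging.blockAvg (P := P) (j := i) ℰp) (j + 1) =
          avgFun ℰp ∘ Averaging.iter (fun i => BlockAveraging.blockAvg (P := P) (j := i) ℰp) j from rfl,
        ← Measure.map_map hma hmi]
      exact (ih.map hma).trans (BlockAveragingEMLHaarAC.haarAC_avgFun_expMeanLogSU_of_le (P := P) (j := j) hj)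

/-- ★★ **LEVEL OFF THE CENTRAL CHAINS, EVERY LEVEL** (PROVED). [cite: Balaban1987RG1, (0.4) p.253] -/
theorem levelFlat_far (F : T3Family) (K n : ℕ) (hn : n ≤ (F.P K).m + (F.P K).K) (α : ℝ) {t : ℝ} (ht : t ≠ 0)
    {j : ℕ} (hj : j ≤ n) (p : Plaq (F.P K) j)
    (hp : ∀ b ∈ plaqBonds p, ∀ c : PBond (F.P K) n, iterCentralBond j b ≠ iterCentralBond n c)
    (W : GaugeField (F.P K) n (Matrix.specialUnitaryGroup (Fin 2) ℂ)) :
    ∀ᵐ z ∂fieldMeasure (F.P K) 0 (Matrix.specialUnitaryGroup (Fin 2) ℂ),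
      ∀ U : GaugeField (F.P K) 0 (Matrix.specialUnitaryGroup (Fin 2) ℂ),
        (∀ b, (∀ c, iterCentralBond n c ≠ b) → U b = z b) →
        (∀ c, U (iterCentralBond n c) ∈ chainWindow (N := 2) α n U c) →
        Averaging.iter (fun i => BlockAveraging.blockAvg (P := F.P K) (j := i) ℰp) n U = W →
          dist1 (GaugeField.plaqHol (Averaging.iter (fun i => BlockAveraging.blockAvg (P := F.P K) (j := i) ℰp) j U) p) ≠ t := by
  set A := Averaging.iter (fun i => BlockAveraging.blockAvg (P := F.P K) (j := i) ℰp) j with hA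
  have hmi : Measurable A :=
    T4Continuum.measurable_iter _ (fun j => by rw [BlockAveraging.blockAvg_avg]; exact measurable_avgFun _ measurable_expMeanLogSU_E) j
  have h1 : fieldMeasure (F.P K) j (Matrix.specialUnitaryGroup (Fin 2) ℂ)
      {V | dist1 (GaugeField.plaqHol V p) = t} = 0 :=
    PlaquetteVariableHaarLaw.fieldMeasure_setOf_dist1_plaqHol_eq_eq_zero p (haar_setOf_dist1_eq_eq_zero (N := 2) ht)
  have h2 := map_iter_absolutelyContinuous (P := F.P K) j (by omega) h1
  have hnull : fieldMeasure (F.P K) 0 (Matrix.specialUnitaryGroup (Fin 2) ℂ) (A ⁻¹' {V | dist1 (GaugeField.plaqHol V p) = t}) = 0 :=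
    le_antisymm ((Measure.le_map_apply hmi.aemeasurable _).trans h2.le) bot_le
  rw [← compl_mem_ae_iff] at hnull
  filter_upwards [hnull] with z hz U hUz _ _
  have hfar := iter_apply_eq_of_far (P := F.P K) ℰp hn U z hUz j hj
  rw [plaqHol_congr (U' := A z) (fun b hb => hfar b (hp b hb))]
  exact hz

/-- **LEVEL NEAR THE CENTRAL CHAINS (T³, SU(2))** — chain-touching plaquettes avoid the thresholds a.e. (print: Balaban1985UV3, (7) p.257 and (28)-(31) p.263) -/
def LevelFlatNear : Prop :=
  ∀ (F : T3Family) (K n : ℕ), n ≤ (F.P K).m + (F.P K).K → ∀ (α : ℝ), 0 < α → α ≤ 1 / 24 → 64 * α ≤ deltaSU (Fin 2) →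
    157 * α < (((F.P K).L : ℝ) ^ ((F.P K).d - 1))⁻¹ →
    (∀ j (c : PBond (F.P K) (j + 1)), (offCard c : ℝ) / (Fintype.card (Idx (F.P K)) : ℝ) + 150 * α < 1) →
    ∀ (t : ℕ → ℝ), (∀ j, t j ≠ 0) → ∀ (W : GaugeField (F.P K) n (Matrix.specialUnitaryGroup (Fin 2) ℂ)),
      ∀ᵐ z ∂fieldMeasure (F.P K) 0 (Matrix.specialUnitaryGroup (Fin 2) ℂ),
        ∀ U : GaugeField (F.P K) 0 (Matrix.specialUnitaryGroup (Fin 2) ℂ),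
          (∀ b, (∀ c, iterCentralBond n c ≠ b) → U b = z b) →
          (∀ c, U (iterCentralBond n c) ∈ chainWindow (N := 2) α n U c) →
          Averaging.iter (fun i => BlockAveraging.blockAvg (P := F.P K) (j := i) ℰp) n U = W →
            ∀ j, j < n → ∀ p : Plaq (F.P K) j,
              (∃ b ∈ plaqBonds p, ∃ c : PBond (F.P K) n, iterCentralBond j b = iterCentralBond n c) →
              dist1 (GaugeField.plaqHol (Averaging.iter (fun i => BlockAveraging.blockAvg (P := F.P K) (j := i) ℰp) j U) p) ≠ t j

/-- ★★ **LEVEL = LEVEL-NEAR + LEVEL-FAR (PROVED)**. [cite: Balaban1987RG1, (0.4) p.253] -/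
theorem levelFlat_of_near (h : LevelFlatNear) : LevelFlat := by
  intro F K n hn α hα0 hα24 hα64 hαL hgap t ht W
  have hfar : ∀ j : ℕ, ∀ᵐ z ∂fieldMeasure (F.P K) 0 (Matrix.specialUnitaryGroup (Fin 2) ℂ), ∀ p : Plaq (F.P K) j,
      (∀ b ∈ plaqBonds p, ∀ c : PBond (F.P K) n, iterCentralBond j b ≠ iterCentralBond n c) → j ≤ n →
        ∀ U : GaugeField (F.P K) 0 (Matrix.specialUnitaryGroup (Fin 2) ℂ),
          (∀ b, (∀ c, iterCentralBond n c ≠ b) → U b = z b) →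
          (∀ c, U (iterCentralBond n c) ∈ chainWindow (N := 2) α n U c) →
          Averaging.iter (fun i => BlockAveraging.blockAvg (P := F.P K) (j := i) ℰp) n U = W →
            dist1 (GaugeField.plaqHol (Averaging.iter (fun i => BlockAveraging.blockAvg (P := F.P K) (j := i) ℰp) j U) p) ≠ t j := by
    intro j
    refine ae_all_iff.2 fun p => ?_
    by_cases hp : ∀ b ∈ plaqBonds p, ∀ c : PBond (F.P K) n, iterCentralBond j b ≠ iterCentralBond n c
    · by_cases hj : j ≤ n
      · filter_upwards [levelFlat_far F K n hn α (ht j) hj p hp W] with z hz _ _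
        exact hz
      · exact Filter.Eventually.of_forall fun z _ hj' => absurd hj' hj
    · exact Filter.Eventually.of_forall fun z hp' => absurd hp' hp
  filter_upwards [h F K n hn α hα0 hα24 hα64 hαL hgap t ht W, ae_all_iff.2 hfar] with z hnear hfz U hUz hch hW j hj p
  by_cases hp : ∀ b ∈ plaqBonds p, ∀ c : PBond (F.P K) n, iterCentralBond j b ≠ iterCentralBond n c
  · exact hfz j p hp hj.le U hUz hch hW
  · have hex : ∃ b ∈ plaqBonds p, ∃ c : PBond (F.P K) n, iterCentralBond j b = iterCentralBond n c := by
      by_contra hcon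
      exact hp fun b hb c hbc => hcon ⟨b, hb, c, hbc⟩
    exact hnear U hUz hch hW j hj p hex

end FarRungs


end Summit.QuantumFields.YangMills.Theorems.FluctuationComparisonRegPrIntLWregInterior

end
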